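import Mathlib
import HarnessLib.Audit
import Summits.PneNP.PneNP.Theorems.PstarNoDeadCentre

/-!
# The single-query rung for every parity, and the reader-graph induction (ROUND-24, item T24.17)

FRONTIER range-avoidance ladder, rung F-N3, ROUND 24 (cell `pnp-ideate`, planner seat p3; restricted-model proof complexity —
nothing here bears on `P` versus `NP`).

`GapOneAll` (T24.17, paper-proved in the planner memo ROUND-24-PRESEED §13 R10(p)): on pure, typed, boundary-expanding `P⋆` instances
with simple overlaps, ONE parity constraint never makes a non-empty output set `J` (`|J| ≤ r`) minimally infeasible; hence the first
rung `PstarGapOne.PstarGapOne` of the crux holds with `K = 0`, uniformly in the degree bound (`pstarGapOne_of_gapOneAll`).  All of the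
crux `PstarGapLemma.PstarGapLemmaSO` therefore lives at `|W| ≥ 2`.

The proof is an induction over the output set in which the parity is generalised to a G-CONSTRAINT
`Σ_{v∈C} z_v + Σ_{g∈G} z_{p_g}·z_{q_g} = b` (`G` a set of outputs OUTSIDE `J`, contributing the products of their AND pairs) —
`GSat` below is that induction statement (T24.17′), recorded so that provers can prove it as stated and derive `GapOneAll` from its
case `G = ∅`.  Step summary (memo R10(p)): a private XOR slot outside `C` is flipped; an output with both XOR slots private is moved
into `G` (its AND pair becomes a monomial); a chord `g = (p,p';u,v)` forces `w|_{a_p=a_{p'}=1}` to be constant on the solutions of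
`J − g`, so by induction that restriction is a constant polynomial (no XOR part, every monomial meets `{p,p'}`); without chords an
output with a private XOR and a private AND slot would make an AND-typed linear parity infeasible (excluded by `GapOneAnd`), so every
output has at most one private variable — against `(3/2)`-expansion; with chords the instance collapses to `≤ 4` outputs on a `C₄` and
is solved by hand.  Ingredients: `CentreFree` / `GapOneAnd` (T24.15/16), simple overlaps (AND pairs of distinct outputs are distinct;
no two outputs on one XOR pair), injective slots (from `IsPure`), expansion of sub-families; NOT `MaxDegree`.
-/

set_option linter.dupNamespace false

open Finset Literature.Computability.Complexity
open Summit.PneNP.PneNP.Theorems.PstarTyped (Typed)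
open Summit.PneNP.PneNP.Theorems.PstarSALevel (BoundaryExpanding SimpleOverlap)
open Summit.PneNP.PneNP.Theorems.PstarPDT (parity)
open Summit.PneNP.PneNP.Theorems.PstarGapLemma (MinInfeasible)
open Summit.PneNP.PneNP.Theorems.PstarGapOne (PstarGapOne)

namespace Summit.PneNP.PneNP.Theorems.PstarGapOneAll

variable {n m : ℕ}

/-- **T24.17 — the single-query rung for every parity (paper-proved, memo §13 R10(p)).**  FRONTIER. -/
@[conjecture] def GapOneAll : Prop :=
  ∀ (n m r : ℕ) (I : LocalMap 4 n m), I.IsPure xorAndPred → Typed I → BoundaryExpanding r I → SimpleOverlap I →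
    ∀ (y : Fin m → Bool) (W : Finset (Finset (Fin n) × Bool)) (J : Finset (Fin m)),
      W.card ≤ 1 → J.card ≤ r → MinInfeasible I y W J → J = ∅

/-- `GapOneAll` gives the first rung `PstarGapOne` with the constant `K = 0` at every degree bound. -/
theorem pstarGapOne_of_gapOneAll (h : GapOneAll) : PstarGapOne := by
  intro Δ
  refine ⟨0, fun n m r I hI hT hB hS _ y W J hW hJ hmin => ?_⟩
  have hJ0 : J = ∅ := h n m r I hI hT hB hS y W J hW hJ hmin
  simp [hJ0]

/-! ## The induction statement: G-constraints -/

/-- Value of the G-constraint `Σ_{v∈C} z_v + Σ_{g∈G} z_{p_g} z_{q_g}` (mod 2) at `z`: the parity of `C` plus the products of the AND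
pairs (slots `2,3`) of the outputs in `G`. -/
def gval (I : LocalMap 4 n m) (C : Finset (Fin n)) (G : Finset (Fin m)) (z : Fin n → Bool) : Bool :=
  xor (parity C z) (decide (Odd (G.filter fun g => z (I.vars g 2) = true ∧ z (I.vars g 3) = true).card))

/-- **T24.17′ — the reader-graph induction statement (paper-proved, memo §13 R10(p)).**  For `J` with `|J| ≤ r` and a set `G` of
outputs disjoint from `J`, every G-constraint that is not constant (takes both values) is satisfiable together with `J`.  The case
`G = ∅` is `GapOneAll`.  FRONTIER. -/
@[conjecture] def GSat : Prop :=
  ∀ (n m r : ℕ) (I : LocalMap 4 n m), I.IsPure xorAndPred → Typed I → BoundaryExpanding r I → SimpleOverlap I →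
    ∀ (y : Fin m → Bool) (J G : Finset (Fin m)) (C : Finset (Fin n)) (b : Bool),
      J.card ≤ r → Disjoint J G → (∃ z z' : Fin n → Bool, gval I C G z ≠ gval I C G z') →
        ∃ z : Fin n → Bool, (∀ j ∈ J, I.eval z j = y j) ∧ gval I C G z = b

/-- With no monomials the G-constraint is the plain parity of `C`. -/
theorem gval_empty (I : LocalMap 4 n m) (C : Finset (Fin n)) (z : Fin n → Bool) : gval I C ∅ z = parity C z := by
  simp [gval]

end Summit.PneNP.PneNP.Theorems.PstarGapOneAll
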